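import Literature.Geometry.Kaehler.ChartTransport
import Literature.Geometry.Kaehler.PluriharmonicLog
import HarnessLib

/-!
# Pluriharmonic conjugates on chart-convex sets: `dd^c u = 0 ⟹ u = Re f`, `f` holomorphic

Layer `Literature/Geometry/Kaehler`; support for the heart of Lefschetz's theorem on
`(1,1)`-classes (`Literature.AlgebraicGeometry.HodgeTheory.lefschetzOneOne_rational`, predicate
`ComplexDeRhamIsoFamily.IsLefschetzOneOne`): the step of the printed construction of the line
bundle with given curvature form (Voisin I, §3.3.1 read backwards; Griffiths–Harris pp. 148–149)
in which the transition functions are produced — on an overlap `U_i ∩ U_j` the difference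
`u = (φ_i − φ_j)/2` of two local potentials of the same real `(1,1)`-form is PLURIHARMONIC
(`∂∂̄ u = 0`, in the tree's spelling `d((du) ∘ J) = 0`, cf. the module docstring of
`HolomorphicLineBundle`: `d((df) ∘ J) = −2i ∂∂̄ f` for real `f`), and on a simply connected open
set a real pluriharmonic function is the real part of a holomorphic function `f = u + iv`
(the pluriharmonic conjugate `v`, `dv = −(du) ∘ J`). This is the converse of
`mextDeriv_compJ_mextDeriv_log_norm_sq_eq_zero` of `PluriharmonicLog` (`log |g|²` is
pluriharmonic for `g` holomorphic invertible).

Main result, PROVED: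

* `exists_mdifferentiableOn_re_eq_of_pluriharmonic` — on the chart set `W = chartSet 𝓘(ℝ, E) p C`
  of an open CONVEX `C` (the members and finite intersections of the chart-convex covers of
  `Literature.NumberTheory.Transcendental.ChartConvexCover`), every real function `u`, `C^∞` at the
  points of `W`, with `d((du) ∘ J) = 0` on `W`, is the real part on `W` of a function `f : M → ℂ`
  holomorphic on `W` (`MDifferentiableOn 𝓘(ℂ, E) 𝓘(ℂ, ℂ) f W`).

Proof: the `1`-form `(du) ∘ J`, restricted to `W`, is closed on `W` by hypothesis, hence exact by
the Poincaré lemma on chart-convex sets (`localClosedForms_chartSet_le_localExactForms`):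
`(du) ∘ J = dg` on `W` for a smooth `g`. Put `f = u − i Re g`. In the chart at a point of `W` the
real differential `L` of `f` satisfies `L(iw) = i L(w)` (from `dg(w) = du(iw)` and `i² = −1`), so it
is `ℂ`-linear (`complexLinearOfCommuteI`) and `f` is complex differentiable there
(`differentiableAt_iff_restrictScalars`), i.e. holomorphic on `W`.

Also recorded: `complexLinearOfCommuteI` (an `ℝ`-linear `E → ℂ` commuting with `i` is
`ℂ`-linear), `mdifferentiableAt_of_hasFDerivAt_commute_I` (the Cauchy–Riemann criterion on a
complex manifold, chart form), and the uniqueness half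
`apply_eq_apply_of_mdifferentiableOn_re_eq_zero` (a holomorphic function with vanishing real part
on a chart-convex set is constant — for the cocycle defects `f_ij + f_jk − f_ik`). No named facts.

## References

* C. Voisin, *Hodge Theory and Complex Algebraic Geometry I* (CUP 2002), §2.2.1 (holomorphic
  charts), Lemma 2.29 (holomorphic ⇔ `ℂ`-linear differential), §3.3.1.
* P. Griffiths, J. Harris, *Principles of Algebraic Geometry* (1978), pp. 148–149.
* J. M. Lee, *Introduction to Smooth Manifolds* (2013), Thm. 17.14 (Poincaré lemma).
-/

noncomputable section

open scoped Manifold ContDiff Topology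
open Bundle Set Filter

namespace Literature.Geometry.Kaehler

/-! ### `ℝ`-linear maps commuting with `i` are `ℂ`-linear -/

section Linear

variable {E : Type*} [NormedAddCommGroup E] [NormedSpace ℂ E]

/-- **An `ℝ`-linear continuous map `E → ℂ` commuting with multiplication by `i` is `ℂ`-linear**
(`c • w = (Re c) • w + (Im c) • (i • w)`). Voisin I, Lemma 2.29 (the differential of a
holomorphic map is `ℂ`-linear, and conversely). [cite: VoisinHodgeI2002, Lemma 2.29] -/
def complexLinearOfCommuteI (L : E →L[ℝ] ℂ) (h : ∀ w : E, L (Complex.I • w) = Complex.I * L w) :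
    E →L[ℂ] ℂ where
  toFun := L
  map_add' := L.map_add
  map_smul' c w := by
    have hc : c • w = (c.re : ℝ) • w + (c.im : ℝ) • (Complex.I • w) := by
      conv_lhs => rw [← Complex.re_add_im c]
      rw [add_smul, mul_smul, Complex.coe_smul, Complex.coe_smul]
    rw [hc, L.map_add, L.map_smul, L.map_smul, h, RingHom.id_apply, Complex.real_smul,
      Complex.real_smul, smul_eq_mul]
    conv_rhs => rw [← Complex.re_add_im c]
    ring
  cont := L.cont

/-- `complexLinearOfCommuteI L h` is `L` as a function. [folklore] -/
@[simp]
theorem complexLinearOfCommuteI_apply (L : E →L[ℝ] ℂ)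
    (h : ∀ w : E, L (Complex.I • w) = Complex.I * L w) (w : E) :
    complexLinearOfCommuteI L h w = L w :=
  rfl

/-- Restricting the scalars back gives `L`. [folklore] -/
theorem restrictScalars_complexLinearOfCommuteI (L : E →L[ℝ] ℂ)
    (h : ∀ w : E, L (Complex.I • w) = Complex.I * L w) :
    (complexLinearOfCommuteI L h).restrictScalars ℝ = L :=
  ContinuousLinearMap.ext fun _ ↦ rfl

end Linear

/-! ### The Cauchy–Riemann criterion on a complex manifold, chart form -/

section CauchyRiemann

variable {E : Type*} [NormedAddCommGroup E] [NormedSpace ℂ E]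
  {M : Type*} [TopologicalSpace M] [ChartedSpace E M]

/-- **Cauchy–Riemann on a complex manifold (chart form).** If `f : M → ℂ`, read in the chart at
`x` (the same partial equivalence for `𝓘(ℝ, E)` and `𝓘(ℂ, E)`), has a real Fréchet derivative `L`
at the centre which commutes with `i`, then `f` is complex differentiable at `x`
(`MDifferentiableAt 𝓘(ℂ, E) 𝓘(ℂ, ℂ)`). Voisin I, Lemma 2.29. [cite: VoisinHodgeI2002, Lemma 2.29] -/
theorem mdifferentiableAt_of_hasFDerivAt_commute_I {f : M → ℂ} {x : M} {L : E →L[ℝ] ℂ}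
    (hF : HasFDerivAt (f ∘ (extChartAt 𝓘(ℝ, E) x).symm) L (extChartAt 𝓘(ℝ, E) x x))
    (hL : ∀ w : E, L (Complex.I • w) = Complex.I * L w) :
    MDifferentiableAt 𝓘(ℂ, E) 𝓘(ℂ, ℂ) f x := by
  set e := extChartAt 𝓘(ℝ, E) x with he
  -- complex differentiability in the chart
  have hFd : DifferentiableAt ℂ (f ∘ e.symm) (e x) :=
    (differentiableAt_iff_restrictScalars ℝ hF.differentiableAt).2
      ⟨complexLinearOfCommuteI L hL, by rw [restrictScalars_complexLinearOfCommuteI, hF.fderiv]⟩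
  -- continuity at `x`
  have hfc : ContinuousAt f x := by
    have h2 : ContinuousAt ((f ∘ e.symm) ∘ e) x :=
      hF.continuousAt.comp (continuousAt_extChartAt (I := 𝓘(ℝ, E)) x)
    refine h2.congr ?_
    filter_upwards [extChartAt_source_mem_nhds (I := 𝓘(ℝ, E)) x] with z hz
    show f (e.symm (e z)) = f z
    rw [e.left_inv hz]
  rw [mdifferentiableAt_iff]
  refine ⟨hfc, ?_⟩
  simp only [writtenInExtChartAt, extChartAt_model_space_eq_id, PartialEquiv.refl_coe,
    Function.id_comp, ModelWithCorners.Boundaryless.range_eq_univ, differentiableWithinAt_univ]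
  exact hFd

/-- The value of a `0`-form recovers it: `ofFun (z ↦ β z 0) = β`. [folklore] -/
theorem MForm.ofFun_apply_zero_eq (β : MForm 𝓘(ℝ, E) M ℂ 0) :
    (MForm.ofFun 𝓘(ℝ, E) fun z ↦ β z 0) = β := by
  funext z
  ext v
  rw [MForm.ofFun_apply]
  exact congrArg (β z) (Subsingleton.elim _ _)

end CauchyRiemann

/-! ### Holomorphic functions with vanishing real part on a chart-convex set are constant -/

section Constant

variable {E : Type*} [NormedAddCommGroup E] [NormedSpace ℂ E]
  {M : Type*} [TopologicalSpace M] [ChartedSpace E M] [IsManifold 𝓘(ℂ, E) ω M]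

omit [NormedSpace ℂ E] in
/-- A `ℂ`-linear functional with identically zero real part is zero
(`Im (D w) = −Re (D (i w))`). [folklore] -/
theorem eq_zero_of_forall_re_eq_zero [NormedSpace ℂ E] (D : E →L[ℂ] ℂ)
    (h : ∀ w, (D w).re = 0) : D = 0 := by
  ext w
  refine Complex.ext (by simpa using h w) ?_
  have h2 := h (Complex.I • w)
  rw [D.map_smul, smul_eq_mul, Complex.I_mul_re] at h2
  simp only [zero_apply, Complex.zero_im]
  linarith

/-- **A holomorphic function with vanishing real part on a chart-convex set is constant there**
(the uniqueness half of the pluriharmonic conjugate: on the connected `W = chartSet 𝓘(ℝ, E) p C`,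
`C` open convex, two holomorphic functions with the same real part differ by an imaginary
constant). Read in the chart at `p`, the function is complex differentiable on the convex `C`
with derivative `D`; `Re ∘ D = 0` because the real part is constant, so `D = 0`
(`eq_zero_of_forall_re_eq_zero`) and the mean value theorem on the convex `C` concludes
(`Convex.is_const_of_fderivWithin_eq_zero`). Used for the cocycle defects
`f_ij + f_jk − f_ik` of the transition functions of Lefschetz `(1,1)` (Griffiths–Harris p. 149).
[cite: GriffithsHarris1978, p. 149] -/
theorem apply_eq_apply_of_mdifferentiableOn_re_eq_zero (p : M) {C : Set E} (hC : IsOpen C)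
    (hCc : Convex ℝ C) (hCT : C ⊆ (extChartAt 𝓘(ℝ, E) p).target) {F : M → ℂ}
    (hF : MDifferentiableOn 𝓘(ℂ, E) 𝓘(ℂ, ℂ) F (chartSet 𝓘(ℝ, E) p C))
    (hre : ∀ x ∈ chartSet 𝓘(ℝ, E) p C, (F x).re = 0) {x y : M}
    (hx : x ∈ chartSet 𝓘(ℝ, E) p C) (hy : y ∈ chartSet 𝓘(ℝ, E) p C) : F x = F y := by
  have hW : IsOpen (chartSet 𝓘(ℝ, E) p C) := isOpen_chartSet 𝓘(ℝ, E) p hC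
  set e := extChartAt 𝓘(ℝ, E) p with he_def
  -- points of `C` come from points of the chart set
  have hmem : ∀ z ∈ C, e.symm z ∈ chartSet 𝓘(ℝ, E) p C := fun z hz ↦
    ⟨e.map_target (hCT hz), by show e (e.symm z) ∈ C; rwa [e.right_inv (hCT hz)]⟩
  -- `G = F ∘ e⁻¹` is complex differentiable on `C`
  set G : E → ℂ := F ∘ e.symm with hG_def
  have hGd : DifferentiableOn ℂ G C := by
    have h := differentiableOn_comp_extChartAt_symm_of_mdifferentiableOn hF hW p
    exact h.mono fun z hz ↦ ⟨hCT hz, hmem z hz⟩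
  -- with vanishing derivative
  have hG0 : ∀ z ∈ C, fderiv ℝ G z = 0 := by
    intro z hz
    have hzd : DifferentiableAt ℂ G z := hGd.differentiableAt (hC.mem_nhds hz)
    have hD : HasFDerivAt G ((fderiv ℂ G z).restrictScalars ℝ) z :=
      hzd.hasFDerivAt.restrictScalars ℝ
    have h1 : HasFDerivAt (fun y ↦ (G y).re)
        (Complex.reCLM.comp ((fderiv ℂ G z).restrictScalars ℝ)) z :=
      Complex.reCLM.hasFDerivAt.comp z hD
    have h2 : HasFDerivAt (fun y ↦ (G y).re) (0 : E →L[ℝ] ℝ) z := by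
      refine (hasFDerivAt_const (0 : ℝ) z).congr_of_eventuallyEq ?_
      filter_upwards [hC.mem_nhds hz] with y hy
      exact hre _ (hmem y hy)
    have h3 : Complex.reCLM.comp ((fderiv ℂ G z).restrictScalars ℝ) = 0 := h1.unique h2
    have hD0 : fderiv ℂ G z = 0 :=
      eq_zero_of_forall_re_eq_zero _ fun w ↦ by simpa using DFunLike.congr_fun h3 w
    rw [hD.fderiv, hD0, ContinuousLinearMap.restrictScalars_zero]
  -- hence `G` is constant on the convex `C`, and `F = G ∘ e` on the chart set
  have hGc : G (e x) = G (e y) :=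
    hCc.is_const_of_fderivWithin_eq_zero (hGd.restrictScalars ℝ)
      (fun z hz ↦ by rw [fderivWithin_of_isOpen hC hz, hG0 z hz]) hx.2 hy.2
  simp only [hG_def, Function.comp_apply, e.left_inv hx.1, e.left_inv hy.1] at hGc
  exact hGc

end Constant

/-! ### Pluriharmonic conjugates on chart-convex sets -/

section Conjugate

variable {E : Type*} [NormedAddCommGroup E] [NormedSpace ℂ E] [FiniteDimensional ℂ E]
  {M : Type*} [TopologicalSpace M] [ChartedSpace E M] [IsManifold 𝓘(ℝ, E) ∞ M]
  [IsManifold 𝓘(ℂ, E) ω M]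

/-- **Pluriharmonic conjugate on a chart-convex set.** Let `W = chartSet 𝓘(ℝ, E) p C` be the chart
set of an open convex `C` contained in the target of the chart at `p`, and `u : M → ℝ` a function
`C^∞` at the points of `W` with `d((du) ∘ J) = 0` on `W` (`u` pluriharmonic: `∂∂̄ u = 0`). Then
there is `f : M → ℂ`, holomorphic on `W`, with `Re f = u` on `W` — namely `f = u − i Re g` where
`dg = (du) ∘ J` on `W` (Poincaré lemma on the chart-convex `W`). Griffiths–Harris pp. 148–149
(construction of the holomorphic transition functions from local potentials); Voisin I,
Lemma 2.29. [cite: GriffithsHarris1978, pp. 148–149] [cite: VoisinHodgeI2002, Lemma 2.29] -/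
theorem exists_mdifferentiableOn_re_eq_of_pluriharmonic (p : M) {C : Set E} (hC : IsOpen C)
    (hCc : Convex ℝ C) (hCT : C ⊆ (extChartAt 𝓘(ℝ, E) p).target) {u : M → ℝ}
    (hu : ∀ x ∈ chartSet 𝓘(ℝ, E) p C, ContMDiffAt 𝓘(ℝ, E) 𝓘(ℝ, ℝ) ∞ u x)
    (hdd : ∀ x ∈ chartSet 𝓘(ℝ, E) p C,
      mextDeriv (mextDeriv (MForm.ofFun 𝓘(ℝ, E) fun z ↦ (u z : ℂ))).compJ x = 0) :
    ∃ f : M → ℂ, MDifferentiableOn 𝓘(ℂ, E) 𝓘(ℂ, ℂ) f (chartSet 𝓘(ℝ, E) p C) ∧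
      ∀ x ∈ chartSet 𝓘(ℝ, E) p C, (f x).re = u x := by
  set W := chartSet 𝓘(ℝ, E) p C with hW_def
  have hW : IsOpen W := isOpen_chartSet 𝓘(ℝ, E) p hC
  -- the complexified function `uC` and the `1`-form `α = (d uC) ∘ J`
  set uC : M → ℂ := fun z ↦ (u z : ℂ) with huC_def
  have huC : ∀ x ∈ W, ContMDiffAt 𝓘(ℝ, E) 𝓘(ℝ, ℂ) ∞ uC x := fun x hx ↦
    Complex.ofRealCLM.contDiff.comp_contMDiffAt (hu x hx)
  have hsm0 : ∀ x ∈ W, (MForm.ofFun 𝓘(ℝ, E) uC).SmoothAt x := fun x hx ↦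
    MForm.smoothAt_ofFun_of_contMDiffAt (huC x hx)
  set α : MForm 𝓘(ℝ, E) M ℂ 1 := (mextDeriv (MForm.ofFun 𝓘(ℝ, E) uC)).compJ with hα_def
  have hαs : ∀ x ∈ W, α.SmoothAt x := fun x hx ↦
    (MForm.SmoothAt.mextDeriv (Filter.eventually_of_mem (hW.mem_nhds hx) hsm0)).compJ
  -- `α|_W` is a closed `1`-form on `W`, hence exact (Poincaré lemma on the chart-convex `W`)
  have hαW : α.restr W ∈ localClosedForms 𝓘(ℝ, E) ℂ 1 W := by
    refine ⟨⟨fun x hx ↦ (MForm.smoothAt_restr_iff hW α hx).2 (hαs x hx),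
      fun x hx ↦ MForm.restr_apply_of_notMem α hx⟩, fun x hx ↦ ?_⟩
    rw [mextDeriv_restr_apply hW α hx]
    exact hdd x hx
  have hαex := localClosedForms_chartSet_le_localExactForms (I := 𝓘(ℝ, E)) (F := ℂ) (k := 0)
    p hC hCc hCT hαW
  obtain ⟨β, hβ⟩ := (mem_localExactForms_succ_iff hW).1 hαex
  -- the primitive `g` (`dg = α` on `W`)
  set g : M → ℂ := fun z ↦ (β : MForm 𝓘(ℝ, E) M ℂ 0) z 0 with hg_def
  have hgβ : MForm.ofFun 𝓘(ℝ, E) g = (β : MForm 𝓘(ℝ, E) M ℂ 0) := MForm.ofFun_apply_zero_eq _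
  have hdg : ∀ x ∈ W, mextDeriv (MForm.ofFun 𝓘(ℝ, E) g) x = α x := fun x hx ↦ by
    rw [hgβ, ← localD_apply_of_mem hW β hx, hβ, MForm.restr_apply_of_mem α hx]
  have hgs : ∀ x ∈ W, (MForm.ofFun 𝓘(ℝ, E) g).SmoothAt x := fun x hx ↦ by
    rw [hgβ]
    exact β.2.1 x hx
  -- the function `f = u − i Re g`
  set f : M → ℂ := fun z ↦ (u z : ℂ) - Complex.I * ((g z).re : ℂ) with hf_def
  refine ⟨f, fun x hx ↦ (?_ : MDifferentiableAt 𝓘(ℂ, E) 𝓘(ℂ, ℂ) f x).mdifferentiableWithinAt,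
    fun x hx ↦ by simp [hf_def]⟩
  -- complex differentiability at `x ∈ W`, read in the chart `e` at `x`
  set e := extChartAt 𝓘(ℝ, E) x with he_def
  set c : E := e x with hc_def
  have hud : DifferentiableAt ℝ (u ∘ e.symm) c := by
    have h := (contMDiffAt_iff.1 (hu x hx)).2
    simp only [extChartAt_model_space_eq_id, PartialEquiv.refl_coe, Function.id_comp,
      ModelWithCorners.Boundaryless.range_eq_univ] at h
    exact (h.contDiffAt univ_mem).differentiableAt (by simp)
  have hgd : DifferentiableAt ℝ (g ∘ e.symm) c := by
    have h := (MForm.smoothAt_ofFun_iff g x).1 (hgs x hx)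
    simp only [ModelWithCorners.Boundaryless.range_eq_univ] at h
    exact (h.contDiffAt univ_mem).differentiableAt (by simp)
  -- `dg = (du) ∘ J` at `x`, read in the chart: `D(g ∘ e⁻¹)(c) w = D(u ∘ e⁻¹)(c) (i w)`
  have hrel : ∀ w : E, fderiv ℝ (g ∘ e.symm) c w =
      ((fderiv ℝ (u ∘ e.symm) c (Complex.I • w) : ℝ) : ℂ) := by
    intro w
    have h2 := mextDeriv_ofFun_apply (I := 𝓘(ℝ, E)) g x fun _ ↦ w
    have h3 := mextDeriv_ofFun_apply (I := 𝓘(ℝ, E)) uC x fun _ ↦ tangentJ E x w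
    simp only [ModelWithCorners.Boundaryless.range_eq_univ, fderivWithin_univ, tangentJ_apply]
      at h2 h3
    have hcomp : fderiv ℝ (uC ∘ e.symm) c (Complex.I • w) =
        ((fderiv ℝ (u ∘ e.symm) c (Complex.I • w) : ℝ) : ℂ) := by
      have h : uC ∘ e.symm = Complex.ofRealCLM ∘ (u ∘ e.symm) := rfl
      rw [h, fderiv_comp _ Complex.ofRealCLM.differentiableAt hud, ContinuousLinearMap.fderiv]
      rfl
    calc fderiv ℝ (g ∘ e.symm) c w
        = mextDeriv (MForm.ofFun 𝓘(ℝ, E) g) x (fun _ ↦ w) := h2.symm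
      _ = α x (fun _ ↦ w) := DFunLike.congr_fun (hdg x hx) _
      _ = mextDeriv (MForm.ofFun 𝓘(ℝ, E) uC) x (fun _ ↦ tangentJ E x w) := rfl
      _ = fderiv ℝ (uC ∘ e.symm) c (Complex.I • w) := h3
      _ = ((fderiv ℝ (u ∘ e.symm) c (Complex.I • w) : ℝ) : ℂ) := hcomp
  -- the real derivative of `f ∘ e⁻¹` at `c`
  set Du : E →L[ℝ] ℝ := fderiv ℝ (u ∘ e.symm) c with hDu_def
  set Dg : E →L[ℝ] ℂ := fderiv ℝ (g ∘ e.symm) c with hDg_def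
  have hF : HasFDerivAt (f ∘ e.symm)
      (Complex.ofRealCLM.comp Du -
        Complex.I • Complex.ofRealCLM.comp (Complex.reCLM.comp Dg)) c := by
    have h1 : HasFDerivAt (fun y ↦ (((u ∘ e.symm) y : ℝ) : ℂ)) (Complex.ofRealCLM.comp Du) c :=
      Complex.ofRealCLM.hasFDerivAt.comp c hud.hasFDerivAt
    have h2 : HasFDerivAt (fun y ↦ ((((g ∘ e.symm) y).re : ℝ) : ℂ))
        (Complex.ofRealCLM.comp (Complex.reCLM.comp Dg)) c :=
      Complex.ofRealCLM.hasFDerivAt.comp c (Complex.reCLM.hasFDerivAt.comp c hgd.hasFDerivAt)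
    exact h1.sub (h2.const_mul Complex.I)
  -- it commutes with `i` (Cauchy–Riemann): `i² = −1`
  refine mdifferentiableAt_of_hasFDerivAt_commute_I hF fun w ↦ ?_
  have hIIw : Complex.I • (Complex.I • w) = -w := by
    rw [smul_smul, Complex.I_mul_I, neg_one_smul]
  simp only [sub_apply, smul_apply, ContinuousLinearMap.comp_apply, Complex.ofRealCLM_apply,
    Complex.reCLM_apply, smul_eq_mul, hrel, Complex.ofReal_re, hIIw, map_neg, Complex.ofReal_neg]
  have hI : Complex.I * Complex.I = -1 := Complex.I_mul_I
  linear_combination ((Du (Complex.I • w) : ℝ) : ℂ) * hI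

end Conjugate

end Literature.Geometry.Kaehler

end
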